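import Summits.QuantumFields.YangMills.Theorems.BalabanUVNodesN08HaarCompatibilityPrivateSources

/-!
# BalabanUVNodes ∕ N08 — E6′ AT THE RECORD IS A STATEMENT ABOUT GAUGE-INVARIANT OBSERVABLES ONLY: two gauge-invariant probability laws on the coarse fields that agree on
# every bounded measurable GAUGE-INVARIANT observable are EQUAL (average over the compact gauge group); hence, for every covariant averaging of the standing range and
# at the [B10] slot's `avOfPrint N S j`, `Ū_*(dU) = dV ⟺ ∫ φ(Ū U) dU = ∫ φ dV for all gauge-invariant φ ⟺ ∫ T1·φ dV = ∫ φ dV for all gauge-invariant φ` (every version `𝔗`)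

WIDTH SEAT `pub-ymgap-dag-n08-w3` g0, plan `W-SEAT-START-LIST.md` §n08 item 3 PART 5, 2026-08-28.  Track A, DAG node N08 = [Balaban1985UV3] Thm 1 p. 257 (compact) + Thm 2
p. 272; key item K1⁷ `StabilityBAtRecordR13SepCoPH` (stmt-QuantumFields-20542), `--supports … --as helper`.  COUNT-NEUTRAL.  Parts 1–4: `…Inhabited` (p583667), `…OneBond`
(p585871), `…PrivateSources` (p588078), `…Forests`.  Those showed the E6′ identity `(T1)·dV = dV` HOLDS on one-bond ∕ private-endpoint ∕ forest σ-algebras.  This part says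
EXACTLY what is left: by [Balaban1987RG1] p. 265 («the δ-functions in (2.1) are invariant under the gauge transformations V → V^v», tree `map_gaugeAct_imageLaw`) the image law is
gauge invariant, `dV` is gauge invariant ([Balaban1985Averaging] (12) p. 19), and two gauge-invariant laws are equal iff they agree on gauge-INVARIANT observables — so E6′
is the statement that every bounded measurable gauge-invariant functional of the coarse field (a functional of holonomies up to conjugation) has the same expectation under
`Ū_*(dU)` as under `dV`.  NO topology on `G`: only the product Haar probability on the gauge group `Site → G` and Fubini.

WHAT THIS FILE PROVES ([folklore] measure theory + the two cited sentences; nothing of Bałaban's asserted; E6′ neither proved nor refuted):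
* §1 the gauge group's product Haar probability `du` (written inline as `Measure.pi`), `measurable_gaugeAct_uncurry`, `gaugeAct_mul` (`V^{uw} = (V^w)^u`),
  `integral_comp_mul_right_transf` (`du` is right invariant), the GAUGE AVERAGE `V ↦ ∫ g(V^u) du` of a bounded measurable `g`: `stronglyMeasurable_gaugeAvg`,
  `gaugeAvg_gaugeAct` (it is gauge invariant), `abs_gaugeAvg_le`, and `integral_eq_integral_gaugeAvg` (a gauge-invariant law integrates `g` and its gauge average alike);
  **`measure_eq_of_forall_gaugeInvariant`** — two gauge-invariant probability laws agreeing on all bounded measurable gauge-invariant observables are equal.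
* §2 for EVERY covariant averaging of the standing range with measurable `Ū`: **`map_avg_eq_iff_forall_gaugeInvariant`** — `Ū_*(dU) = dV ⟺ ∀ gauge-invariant bounded
  measurable φ, ∫ φ(Ū U) dU = ∫ φ dV`.
* §3 at the [B10] slot, every level, every `N`: `map_avOfPrint_eq_iff_forall_gaugeInvariant` and, in the letters of `B10Eq2HaarCompatibility`, for EVERY version family
  `𝔗 : Node00.TFamily₃ N L`: **`map_avOfPrint_eq_iff_forall_gaugeInvariant_T_one`** — `E6′(S, j) ⟺ ∀ gauge-invariant bounded measurable φ, ∫ (𝔗 S j).T 1 · φ dV = ∫ φ dV`.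
HONEST FRAMING.  Count-neutral helper; N08 NOT discharged; E6′ proper NOT IN PRINT and undecided at `N ≥ 2` (pub-balaban3d DEPMAP v6 §16 N22; dag-n08-a SEAM note; chair R451);
one finite 𝕋⁴ programme at fixed ε; R4 closes the CONDITIONAL rung `BalabanLadder.UV` only; the Yang–Mills mass gap (Clay) is NOT proved by any of this; nothing continuum ∕
ℝ³ ∕ ℝ⁴ ∕ OS ∕ mass gap.  0 `sorry`, 0 `def`, 0 `instance`, standard axioms.
-/

noncomputable section

open MeasureTheory

namespace Summit.QuantumFields.YangMills.BalabanUVNodes.N08HaarCompatibilityInvariantObservables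

open Literature.MathematicalPhysics.QuantumFieldTheory.Balaban1983to89
open Literature.MathematicalPhysics.QuantumFieldTheory.Balaban1983to89.AveragingRT (integrable_of_abs_le)
open Literature.MathematicalPhysics.QuantumFieldTheory.Balaban1983to89.AveragingImageLawGaugeInvariance (map_gaugeAct_imageLaw isProbabilityMeasure_imageLaw)
open Literature.MathematicalPhysics.QuantumFieldTheory.Balaban1983to89.B12RTGaugeInvariance254 (measurable_gaugeAct measurePreserving_gaugeAct)
open Summit.QuantumFields.YangMills.BalabanUVNodes.N08HaarCompatibilityPrivateSources (map_gaugeAct_fieldMeasure)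

/-! ## §1 Gauge averaging and the separation of gauge-invariant laws by gauge-invariant observables -/

section Generic

variable {P : Params} {k : ℕ} {G : Type*} [GaugeGroup G] [MeasurableSpace G] [HaarData G] [MeasurableMul₂ G] [MeasurableInv G]

omit [MeasurableSpace G] [HaarData G] [MeasurableMul₂ G] [MeasurableInv G] in
/-- `V^{u·w} = (V^w)^u` for the pointwise product of gauge transformations. [cite: Balaban1985Averaging, (8) p.19 (bookkeeping)] -/
theorem gaugeAct_mul (u w : Site P k → G) (V : GaugeField P k G) :
    GaugeField.gaugeAct (fun x => u x * w x) V = GaugeField.gaugeAct u (GaugeField.gaugeAct w V) := by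
  funext b
  simp only [GaugeField.gaugeAct, mul_inv_rev, mul_assoc]

omit [HaarData G] in
/-- The gauge action is jointly measurable in the transformation and the field. [folklore] -/
theorem measurable_gaugeAct_uncurry :
    Measurable fun p : (Site P k → G) × GaugeField P k G => GaugeField.gaugeAct p.1 p.2 := by
  refine measurable_pi_lambda _ fun b => ?_
  show Measurable fun p : (Site P k → G) × GaugeField P k G => p.1 b.src * p.2 b * (p.1 b.tgt)⁻¹
  have h1 : Measurable fun p : (Site P k → G) × GaugeField P k G => p.1 b.src := (measurable_pi_apply b.src).comp measurable_fst
  have h2 : Measurable fun p : (Site P k → G) × GaugeField P k G => p.2 b :=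
    (measurable_pi_apply b : Measurable fun V : GaugeField P k G => V b).comp measurable_snd
  have h3 : Measurable fun p : (Site P k → G) × GaugeField P k G => p.1 b.tgt := (measurable_pi_apply b.tgt).comp measurable_fst
  exact (h1.mul h2).mul h3.inv

omit [MeasurableInv G] in
/-- The product Haar probability on the gauge group is RIGHT invariant: `∫ h(u·w) du = ∫ h du`. [folklore] -/
theorem integral_comp_mul_right_transf (w : Site P k → G) (h : (Site P k → G) → ℝ) :
    ∫ u, h (fun x => u x * w x) ∂(Measure.pi fun _ : Site P k => (HaarData.haar : Measure G)) =
      ∫ u, h u ∂(Measure.pi fun _ : Site P k => (HaarData.haar : Measure G)) := by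
  have hpi : MeasurePreserving (fun (u : Site P k → G) (x : Site P k) => u x * w x)
      (Measure.pi fun _ : Site P k => (HaarData.haar : Measure G)) (Measure.pi fun _ : Site P k => (HaarData.haar : Measure G)) :=
    measurePreserving_pi (fun _ : Site P k => (HaarData.haar : Measure G)) (fun _ => HaarData.haar)
      (f := fun x (g : G) => g * w x) fun x => ⟨measurable_mul_const (w x), HaarData.map_mul_right (w x)⟩
  have hfun : (⇑(MeasurableEquiv.mulRight w) : (Site P k → G) → (Site P k → G)) = fun u x => u x * w x := by
    funext u x; rfl
  have hmp : MeasurePreserving (MeasurableEquiv.mulRight w)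
      (Measure.pi fun _ : Site P k => (HaarData.haar : Measure G)) (Measure.pi fun _ : Site P k => (HaarData.haar : Measure G)) := by
    rw [hfun]; exact hpi
  have h' := hmp.integral_comp' h
  rw [hfun] at h'
  exact h'

/-- **The gauge average `V ↦ ∫ g(V^u) du` of a measurable `g` is strongly measurable** (Fubini measurability). [folklore] -/
theorem stronglyMeasurable_gaugeAvg {g : GaugeField P k G → ℝ} (hg : Measurable g) :
    StronglyMeasurable fun V : GaugeField P k G =>
      ∫ u, g (GaugeField.gaugeAct u V) ∂(Measure.pi fun _ : Site P k => (HaarData.haar : Measure G)) := by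
  have hF : StronglyMeasurable fun p : GaugeField P k G × (Site P k → G) => g (GaugeField.gaugeAct p.2 p.1) :=
    (hg.comp (measurable_gaugeAct_uncurry.comp measurable_swap)).stronglyMeasurable
  exact hF.integral_prod_right'

omit [MeasurableInv G] in
/-- **The gauge average is gauge invariant**: `∫ g((V^w)^u) du = ∫ g(V^u) du` (right invariance of `du`, `V^{uw} = (V^w)^u`). [folklore] -/
theorem gaugeAvg_gaugeAct (g : GaugeField P k G → ℝ) (w : Site P k → G) (V : GaugeField P k G) :
    ∫ u, g (GaugeField.gaugeAct u (GaugeField.gaugeAct w V)) ∂(Measure.pi fun _ : Site P k => (HaarData.haar : Measure G)) =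
      ∫ u, g (GaugeField.gaugeAct u V) ∂(Measure.pi fun _ : Site P k => (HaarData.haar : Measure G)) := by
  have h := integral_comp_mul_right_transf (P := P) (k := k) w (fun u => g (GaugeField.gaugeAct u V))
  simp only [gaugeAct_mul] at h
  exact h

omit [MeasurableMul₂ G] [MeasurableInv G] in
/-- `|∫ g(V^u) du| ≤ C` when `|g| ≤ C`. [folklore] -/
theorem abs_gaugeAvg_le {g : GaugeField P k G → ℝ} {C : ℝ} (hC : ∀ V, |g V| ≤ C) (V : GaugeField P k G) :
    |∫ u, g (GaugeField.gaugeAct u V) ∂(Measure.pi fun _ : Site P k => (HaarData.haar : Measure G))| ≤ C := by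
  have h := norm_integral_le_of_norm_le_const (μ := Measure.pi fun _ : Site P k => (HaarData.haar : Measure G))
    (f := fun u => g (GaugeField.gaugeAct u V)) (C := C) (Filter.Eventually.of_forall fun u => by
      rw [Real.norm_eq_abs]; exact hC _)
  rw [Real.norm_eq_abs] at h
  simpa using h

/-- **A gauge-invariant law integrates `g` and its gauge average alike**: `∫ g dμ = ∫ (∫ g(V^u) du) dμ(V)` (Fubini + `μ ∘ (·^u)⁻¹ = μ`). [folklore] -/
theorem integral_eq_integral_gaugeAvg (μ : Measure (GaugeField P k G)) [IsProbabilityMeasure μ]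
    (hμ : ∀ u : GaugeTransf P k G, μ.map (GaugeField.gaugeAct u) = μ)
    {g : GaugeField P k G → ℝ} (hg : Measurable g) {C : ℝ} (hC : ∀ V, |g V| ≤ C) :
    ∫ V, g V ∂μ = ∫ V, (∫ u, g (GaugeField.gaugeAct u V) ∂(Measure.pi fun _ : Site P k => (HaarData.haar : Measure G))) ∂μ := by
  set du : Measure (Site P k → G) := Measure.pi fun _ : Site P k => (HaarData.haar : Measure G) with hdu
  -- the integrand on the product is bounded measurable, hence integrable
  have hF : Measurable fun p : GaugeField P k G × (Site P k → G) => g (GaugeField.gaugeAct p.2 p.1) :=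
    hg.comp (measurable_gaugeAct_uncurry.comp measurable_swap)
  have hInt : Integrable (fun p : GaugeField P k G × (Site P k → G) => g (GaugeField.gaugeAct p.2 p.1)) (μ.prod du) :=
    integrable_of_abs_le hF C fun p => hC _
  rw [integral_integral_swap hInt]
  -- inner integral in `V` at fixed `u`: `∫ g(V^u) dμ(V) = ∫ g dμ`
  have hinner : ∀ u : Site P k → G, ∫ V, g (GaugeField.gaugeAct u V) ∂μ = ∫ V, g V ∂μ := by
    intro u
    have h := integral_map (μ := μ) (measurable_gaugeAct u).aemeasurable (hg.aestronglyMeasurable (μ := μ.map (GaugeField.gaugeAct u)))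
    rw [hμ u] at h
    exact h.symm
  simp_rw [hinner]
  rw [integral_const, probReal_univ, one_smul]

/-- **TWO GAUGE-INVARIANT PROBABILITY LAWS THAT AGREE ON GAUGE-INVARIANT OBSERVABLES ARE EQUAL.**  (Apply the previous identity to indicators: `μ A = ∫ \\overline{1_A} dμ =
∫ \\overline{1_A} dμ' = μ' A`, the gauge average of `1_A` being bounded, measurable and gauge invariant.) [folklore] -/
theorem measure_eq_of_forall_gaugeInvariant (μ μ' : Measure (GaugeField P k G)) [IsProbabilityMeasure μ] [IsProbabilityMeasure μ']
    (hμ : ∀ u : GaugeTransf P k G, μ.map (GaugeField.gaugeAct u) = μ) (hμ' : ∀ u : GaugeTransf P k G, μ'.map (GaugeField.gaugeAct u) = μ')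
    (h : ∀ φ : GaugeField P k G → ℝ, Measurable φ → (∃ C : ℝ, ∀ V, |φ V| ≤ C) → GaugeField.GaugeInvariant φ →
      ∫ V, φ V ∂μ = ∫ V, φ V ∂μ') :
    μ = μ' := by
  ext A hA
  set g : GaugeField P k G → ℝ := A.indicator fun _ => (1 : ℝ) with hgdef
  have hgm : Measurable g := measurable_const.indicator hA
  have hgb : ∀ V, |g V| ≤ 1 := fun V => by
    rw [hgdef]; by_cases hV : V ∈ A <;> simp [Set.indicator, hV]
  set gbar : GaugeField P k G → ℝ := fun V =>
    ∫ u, g (GaugeField.gaugeAct u V) ∂(Measure.pi fun _ : Site P k => (HaarData.haar : Measure G)) with hgbar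
  have hgbar_m : Measurable gbar := (stronglyMeasurable_gaugeAvg hgm).measurable
  have hgbar_b : ∃ C : ℝ, ∀ V, |gbar V| ≤ C := ⟨1, fun V => abs_gaugeAvg_le hgb V⟩
  have hgbar_inv : GaugeField.GaugeInvariant gbar := fun w V => gaugeAvg_gaugeAct g w V
  have e1 : (μ A).toReal = ∫ V, g V ∂μ := by rw [hgdef, integral_indicator_const _ hA, smul_eq_mul, mul_one, measureReal_def]
  have e2 : (μ' A).toReal = ∫ V, g V ∂μ' := by rw [hgdef, integral_indicator_const _ hA, smul_eq_mul, mul_one, measureReal_def]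
  have key : (μ A).toReal = (μ' A).toReal := by
    rw [e1, e2, integral_eq_integral_gaugeAvg μ hμ hgm hgb, integral_eq_integral_gaugeAvg μ' hμ' hgm hgb]
    exact h gbar hgbar_m hgbar_b hgbar_inv
  exact (ENNReal.toReal_eq_toReal_iff' (measure_ne_top μ A) (measure_ne_top μ' A)).1 key

end Generic

/-! ## §2 E6′ for ANY covariant averaging ⟺ agreement with `dV` on gauge-invariant observables -/

section ImageLaw

variable {P : Params} {j : ℕ} {G : Type*} [GaugeGroup G] [MeasurableSpace G] [HaarData G] [MeasurableMul₂ G] [MeasurableInv G]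

/-- **`Ū_*(dU) = dV ⟺ ∫ φ(Ū U) dU = ∫ φ dV` for every bounded measurable GAUGE-INVARIANT `φ`**, for every covariant averaging of the standing range with measurable `Ū`:
exact Haar compatibility is a statement about gauge-invariant observables only. [cite: Balaban1987RG1, (2.1) p.265; Balaban1985Averaging, (12) p.19 (bookkeeping; E6′ itself NOT IN PRINT)] -/
theorem map_avg_eq_iff_forall_gaugeInvariant (hj : j + 1 ≤ P.m + P.K) (av : Averaging P j G) (havg : Measurable av.avg) :
    (fieldMeasure P j G).map av.avg = fieldMeasure P (j + 1) G ↔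
      ∀ φ : GaugeField P (j + 1) G → ℝ, Measurable φ → (∃ C : ℝ, ∀ V, |φ V| ≤ C) → GaugeField.GaugeInvariant φ →
        ∫ U, φ (av.avg U) ∂(fieldMeasure P j G) = ∫ V, φ V ∂(fieldMeasure P (j + 1) G) := by
  refine ⟨fun h φ hφm _ _ => ?_, fun h => ?_⟩
  · rw [← h, integral_map havg.aemeasurable (hφm.aestronglyMeasurable)]
  · haveI := isProbabilityMeasure_imageLaw av havg
    refine measure_eq_of_forall_gaugeInvariant _ _ (map_gaugeAct_imageLaw hj av havg) map_gaugeAct_fieldMeasure fun φ hφm hφb hφi => ?_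
    rw [integral_map havg.aemeasurable (hφm.aestronglyMeasurable)]
    exact h φ hφm hφb hφi

end ImageLaw

/-! ## §3 At the [B10] slot: E6′ in the letters of `B10Eq2HaarCompatibility`, reduced to gauge-invariant observables -/

section Slot

open Literature.MathematicalPhysics.QuantumFieldTheory.Balaban1985CMP102.Setting (Scales)
open Literature.MathematicalPhysics.QuantumFieldTheory.Balaban1983to89.B10RunsOfRecord (avOfPrint TOfPrint)
open Literature.MathematicalPhysics.QuantumFieldTheory.Balaban1983to89.B10Eq2HaarCompatibility
open Literature.MathematicalPhysics.QuantumFieldTheory.Balaban1983to89.Node00 (SU TFamily₃)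
open Summit.QuantumFields.YangMills.BalabanUVNodes.N08HaarCompatibilityOneBond (map_gaugeAct_imageLaw_avOfPrint)

variable (N : ℕ) [NeZero N] {L : ℕ}

/-- **E6′ AT THE RECORD'S AVERAGING ⟺ AGREEMENT ON GAUGE-INVARIANT OBSERVABLES**, every level, every `N`:
`(avOfPrint N S j)_*(dU) = dV ⟺ ∀ gauge-invariant bounded measurable φ, ∫ φ(Ū U) dU = ∫ φ dV`. [cite: Balaban1987RG1, (2.1) p.265, (0.4) p.253 (bookkeeping; E6′ NOT IN PRINT)] -/
theorem map_avOfPrint_eq_iff_forall_gaugeInvariant (S : Scales L) (j : ℕ) :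
    (fieldMeasure S.P j (SU N)).map (avOfPrint N S j).avg = fieldMeasure S.P (j + 1) (SU N) ↔
      ∀ φ : GaugeField S.P (j + 1) (SU N) → ℝ, Measurable φ → (∃ C : ℝ, ∀ V, |φ V| ≤ C) → GaugeField.GaugeInvariant φ →
        ∫ U, φ ((avOfPrint N S j).avg U) ∂(fieldMeasure S.P j (SU N)) = ∫ V, φ V ∂(fieldMeasure S.P (j + 1) (SU N)) := by
  refine ⟨fun h φ hφm _ _ => ?_, fun h => ?_⟩
  · rw [← h, integral_map (measurable_avOfPrint N S j).aemeasurable (hφm.aestronglyMeasurable)]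
  · haveI := isProbabilityMeasure_imageLaw (avOfPrint N S j) (measurable_avOfPrint N S j)
    refine measure_eq_of_forall_gaugeInvariant _ _ (map_gaugeAct_imageLaw_avOfPrint N S j) map_gaugeAct_fieldMeasure
      fun φ hφm hφb hφi => ?_
    rw [integral_map (measurable_avOfPrint N S j).aemeasurable (hφm.aestronglyMeasurable)]
    exact h φ hφm hφb hφi

variable (L) in
/-- **… IN THE LETTERS: `E6′(S, j) ⟺ ∀ gauge-invariant bounded measurable φ, ∫ (𝔗 S j).T 1 · φ dV = ∫ φ dV`**, for EVERY version family `𝔗` of the slot (the push-forward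
identity (10) turns `∫ φ(Ū U) dU` into `∫ T1·φ dV`).  So exact Haar compatibility of print's averaging is EXACTLY the statement that `T1` has conditional expectation `1`
on the gauge-INVARIANT σ-algebra — the open part of E6′ at `N ≥ 2`, said. [cite: Balaban1985Averaging, (10) p.19; Balaban1987RG1, (2.1) p.265 (bookkeeping; E6′ NOT IN PRINT)] -/
theorem map_avOfPrint_eq_iff_forall_gaugeInvariant_T_one (𝔗 : TFamily₃ N L) (S : Scales L) (j : ℕ) :
    (fieldMeasure S.P j (SU N)).map (avOfPrint N S j).avg = fieldMeasure S.P (j + 1) (SU N) ↔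
      ∀ φ : GaugeField S.P (j + 1) (SU N) → ℝ, Measurable φ → (∃ C : ℝ, ∀ V, |φ V| ≤ C) → GaugeField.GaugeInvariant φ →
        ∫ V, (𝔗 S j).T 1 V * φ V ∂(fieldMeasure S.P (j + 1) (SU N)) = ∫ V, φ V ∂(fieldMeasure S.P (j + 1) (SU N)) := by
  rw [map_avOfPrint_eq_iff_forall_gaugeInvariant N S j]
  refine forall_congr' fun φ => forall_congr' fun hφm => forall_congr' fun hφb => forall_congr' fun _ => ?_
  have h := (𝔗 S j).isRT 1 (integrable_const _) φ hφm hφb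
  have h1 : (fun U => (1 : Density S.P j (SU N)) U * φ ((avOfPrint N S j).avg U)) = fun U => φ ((avOfPrint N S j).avg U) := by
    funext U; simp
  rw [h1] at h
  rw [h]

end Slot

end Summit.QuantumFields.YangMills.BalabanUVNodes.N08HaarCompatibilityInvariantObservables

end
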